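import Mathlib
import Summits.ValiantsHypothesis.ValiantsHypothesis.Theses.NewtonUnitEquations
import Summits.ValiantsHypothesis.ValiantsHypothesis.Theorems.NewtonTauWeak.Negative.LoadBearing

/-!
# `LogFactorBound` (stmt-ValiantsHypothesis-16048) and `FewProductsBound` (stmt-ValiantsHypothesis-16052)
# are each EQUIVALENT to the crux `NewtonTauWeak` (stmt-ValiantsHypothesis-5904): padding is free

Support file (prover, item stmt-ValiantsHypothesis-16048) for route NewtonUnitEquations.

The crux `NewtonTauWeak` (KPTT arXiv:1308.2286, Conjecture 1 in the weak form `vert ≤ 2^{a m}(k t+2)^b`)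
was split by regime (crux-strategist, `Cruxes/NewtonTauWeak/RegimeSplit.lean`) into

* R1 `LogFactorBound`: `m ≤ ⌊log₂ k⌋ → vert(Σ_{i<k} Π_{j<m} f_ij) ≤ (k t+2)^b`, and
* R2 `FewProductsBound`: `k ≤ 2^m → vert(Σ_{i<k} Π_{j<m} f_ij) ≤ 2^{a m}(t+2)^b`,

with `NewtonTauWeak ↔ R1 ∧ R2` proved there.  This file shows that the split is DEGENERATE: each half alone is
already equivalent to the crux, because the shape `Σ^k Π^m` can be padded for free —

* `newtonTauWeak_of_logFactorBound`: given any `k, m, t, f`, append `2^m` ZERO products (for `m ≥ 1` a product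
  with a zero factor is `0`, and `0` is `t`-sparse); then `m ≤ log₂(k + 2^m)`, R1 applies, and
  `((k + 2^m) t + 2)^b ≤ 2^{2 b m}(k t + 2)^b`.  Hence R1 → NewtonTauWeak with `a := 2b`.
* `newtonTauWeak_of_fewProductsBound`: append `L := ⌊log₂ k⌋ + 1` UNIT factors to every product (for `t ≥ 1`
  the constant `1` is `t`-sparse); then `k < 2^L ≤ 2^{m+L}`, R2 applies, and
  `2^{a(m+L)}(t+2)^b ≤ 2^{2 a m}(k t+2)^{a+b}`.  Hence R2 → NewtonTauWeak.
* The converses (`logFactorBound_of_newtonTauWeak`, `fewProductsBound_of_newtonTauWeak`) are the elementary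
  halves of `RegimeSplit.subs_of_newtonTauWeak` (re-proved here because `Cruxes/` is not importable from
  `Theorems/`), giving `logFactorBound_iff_newtonTauWeak`, `fewProductsBound_iff_newtonTauWeak` and
  `logFactorBound_iff_fewProductsBound`.

Consequence for the route: neither R1 nor R2 is a proper sub-crux; a regime split of `NewtonTauWeak` along a
relation between `k` and `m` cannot exist (both parameters inflate for free), so any honest split must constrain
padding-invariant structure (dissociated supports, `k = 2`, fixed `k` with its own constant — the route's existing
cruxes).  The statements R1/R2 are kept INLINED (their literal item signatures), exactly as in `RegimeSplit.lean`,
so that the theorem types match the items' terms syntactically.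

No definitions, no named facts, no `sorry`.  [folklore padding argument; KPTT arXiv:1308.2286 §3 pads the same way]
-/

-- the layout `Summit.<Summit>.<Sub>` repeats `ValiantsHypothesis` (single-conjunct summit, D-0017): silence dupNamespace
set_option linter.dupNamespace false

namespace Summit.ValiantsHypothesis.ValiantsHypothesis.Theorems.NewtonUnitEquationsLogFactorBound

open scoped BigOperators
open MvPolynomial
open Summit.ValiantsHypothesis.ValiantsHypothesis.Theses.NewtonUnitEquations (NewtonTauWeak)
open Summit.ValiantsHypothesis.ValiantsHypothesis.Theorems.NewtonTauWeak.Negative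
  (vert vert_le_card_support vert_sum_fin_zero vert_sum_fin_zero')

/-! ## §1 Padding lemmas -/

/-- Appending `n` rows of ZERO factors does not change `Σ_i Π_j f i j` when there is at least one factor
(`m ≥ 1`): every appended product has the factor `0`. -/
theorem sum_prod_append_zero (k n m : ℕ) (hm : 0 < m) (f : Fin k → Fin m → MvPolynomial (Fin 2) ℂ) :
    (∑ i : Fin (k + n), ∏ j, Fin.append f (fun (_ : Fin n) (_ : Fin m) => (0 : MvPolynomial (Fin 2) ℂ)) i j) =
      ∑ i, ∏ j, f i j := by
  rw [Fin.sum_trunc]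
  · simp only [Fin.append_left]
  · intro l
    simp only [Fin.append_right]
    exact Finset.prod_eq_zero (Finset.mem_univ ⟨0, hm⟩) rfl

/-- The zero-padded family is still `t`-sparse. -/
theorem sparse_append_zero (k n m t : ℕ) (f : Fin k → Fin m → MvPolynomial (Fin 2) ℂ)
    (hf : ∀ i j, (f i j).support.card ≤ t) (i : Fin (k + n)) (j : Fin m) :
    (Fin.append f (fun (_ : Fin n) (_ : Fin m) => (0 : MvPolynomial (Fin 2) ℂ)) i j).support.card ≤ t := by
  induction i using Fin.addCases with
  | left i => simpa only [Fin.append_left] using hf i j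
  | right i => simp only [Fin.append_right, MvPolynomial.support_zero, Finset.card_empty, Nat.zero_le]

/-- Appending `L` UNIT factors to a product does not change it. -/
theorem prod_append_one (m L : ℕ) (g : Fin m → MvPolynomial (Fin 2) ℂ) :
    (∏ j : Fin (m + L), Fin.append g (fun (_ : Fin L) => (1 : MvPolynomial (Fin 2) ℂ)) j) = ∏ j, g j := by
  rw [Fin.prod_trunc]
  · simp only [Fin.append_left]
  · intro l
    simp only [Fin.append_right]

/-- The unit-padded family is still `t`-sparse as soon as `t ≥ 1`. -/
theorem sparse_append_one (m L t : ℕ) (ht : 1 ≤ t) (g : Fin m → MvPolynomial (Fin 2) ℂ)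
    (hg : ∀ j, (g j).support.card ≤ t) (j : Fin (m + L)) :
    (Fin.append g (fun (_ : Fin L) => (1 : MvPolynomial (Fin 2) ℂ)) j).support.card ≤ t := by
  induction j using Fin.addCases with
  | left j => simpa only [Fin.append_left] using hg j
  | right j =>
      simp only [Fin.append_right]
      rw [MvPolynomial.support_one, Finset.card_singleton]
      exact ht

/-- With sparsity `t = 0` every factor is `0`; if there is a factor at all (`m ≥ 1`) the whole sum vanishes. -/
theorem sum_prod_eq_zero_of_sparsity_zero (k m : ℕ) (hm : 0 < m) (f : Fin k → Fin m → MvPolynomial (Fin 2) ℂ)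
    (hf : ∀ i j, (f i j).support.card ≤ 0) : (∑ i, ∏ j, f i j) = 0 := by
  refine Finset.sum_eq_zero (fun i _ => Finset.prod_eq_zero (Finset.mem_univ ⟨0, hm⟩) ?_)
  have h0 := hf i ⟨0, hm⟩
  rwa [Nat.le_zero, Finset.card_eq_zero, MvPolynomial.support_eq_empty] at h0

/-- The zero polynomial has no Newton vertices. -/
theorem vert_zero : vert 0 = 0 := by
  simp [vert]

/-! ## §2 R1 (`LogFactorBound`) is equivalent to the crux -/

/-- **Padding products: R1 → crux.**  `LogFactorBound` (the literal signature of stmt-ValiantsHypothesis-16048)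
implies `NewtonTauWeak` with `a := 2 b`: pad the `k` products with `2^m` zero products, so that `m ≤ log₂(k+2^m)`,
and use `((k + 2^m) t + 2)^b ≤ (2^{2m}(k t + 2))^b` (`m, k ≥ 1`; the corners `m = 0`, `k = 0` are trivial). -/
theorem newtonTauWeak_of_logFactorBound
    (h : ∃ b : ℕ, ∀ (k m t : ℕ) (f : Fin k → Fin m → MvPolynomial (Fin 2) ℂ), m ≤ Nat.log 2 k →
      (∀ i j, (f i j).support.card ≤ t) →
        (Set.extremePoints ℝ (convexHull ℝ ((fun e : Fin 2 →₀ ℕ => fun i : Fin 2 => ((e i : ℕ) : ℝ)) ''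
          ((∑ i, ∏ j, f i j).support : Set (Fin 2 →₀ ℕ))))).ncard ≤ (k * t + 2) ^ b) :
    NewtonTauWeak := by
  obtain ⟨b, h⟩ := h
  refine ⟨2 * b, b, ?_⟩
  intro k m t f hf
  show vert (∑ i, ∏ j, f i j) ≤ 2 ^ (2 * b * m) * (k * t + 2) ^ b
  have hbase : 1 ≤ k * t + 2 := by omega
  rcases Nat.eq_zero_or_pos m with rfl | hm
  · calc vert (∑ i, ∏ j, f i j) ≤ 1 := vert_sum_fin_zero' k f
      _ ≤ (k * t + 2) ^ b := Nat.one_le_pow _ _ hbase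
      _ ≤ 2 ^ (2 * b * 0) * (k * t + 2) ^ b := by simp
  rcases Nat.eq_zero_or_pos k with rfl | hk
  · rw [vert_sum_fin_zero]; exact Nat.zero_le _
  -- pad with `2^m` zero products
  have hlog : m ≤ Nat.log 2 (k + 2 ^ m) :=
    calc m = Nat.log 2 (2 ^ m) := (Nat.log_pow one_lt_two m).symm
      _ ≤ Nat.log 2 (k + 2 ^ m) := Nat.log_mono_right (Nat.le_add_left _ _)
  have hle := h (k + 2 ^ m) m t (Fin.append f (fun (_ : Fin (2 ^ m)) (_ : Fin m) => 0)) hlog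
    (sparse_append_zero k (2 ^ m) m t f hf)
  rw [sum_prod_append_zero k (2 ^ m) m hm f] at hle
  change vert (∑ i, ∏ j, f i j) ≤ ((k + 2 ^ m) * t + 2) ^ b at hle
  -- arithmetic: `(k + 2^m) t + 2 ≤ 2^{2m} (k t + 2)` for `k, m ≥ 1`
  have h2m : 1 ≤ 2 ^ m := Nat.one_le_two_pow
  have htk : t ≤ k * t := Nat.le_mul_of_pos_left t hk
  have harith : (k + 2 ^ m) * t + 2 ≤ 2 ^ (2 * m) * (k * t + 2) := by
    have hpow : 2 ^ (m + 1) ≤ 2 ^ (2 * m) := Nat.pow_le_pow_right (by norm_num) (by omega)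
    calc (k + 2 ^ m) * t + 2 = k * t + 2 ^ m * t + 2 := by ring
      _ ≤ 2 ^ m * (k * t) + 2 ^ m * (k * t) + 2 ^ m * 2 := by
          have h1 : k * t ≤ 2 ^ m * (k * t) := Nat.le_mul_of_pos_left _ h2m
          have h2 : 2 ^ m * t ≤ 2 ^ m * (k * t) := Nat.mul_le_mul_left _ htk
          have h3 : 2 ≤ 2 ^ m * 2 := Nat.le_mul_of_pos_left _ h2m
          omega
      _ = 2 ^ (m + 1) * (k * t + 1) := by ring
      _ ≤ 2 ^ (2 * m) * (k * t + 2) := Nat.mul_le_mul hpow (Nat.le_succ _)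
  calc vert (∑ i, ∏ j, f i j) ≤ ((k + 2 ^ m) * t + 2) ^ b := hle
    _ ≤ (2 ^ (2 * m) * (k * t + 2)) ^ b := Nat.pow_le_pow_left harith b
    _ = 2 ^ (2 * b * m) * (k * t + 2) ^ b := by
        rw [mul_pow, ← pow_mul]
        ring_nf

/-- **Crux → R1** (the R1 half of `RegimeSplit.subs_of_newtonTauWeak`, re-proved: `2^{a m} ≤ 2^{a ⌊log₂ k⌋} ≤ k^a
≤ (k t+2)^a`, so `b := a + b` works; `t = 0` makes the sum a constant). -/
theorem logFactorBound_of_newtonTauWeak (h : NewtonTauWeak) :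
    ∃ b : ℕ, ∀ (k m t : ℕ) (f : Fin k → Fin m → MvPolynomial (Fin 2) ℂ), m ≤ Nat.log 2 k →
      (∀ i j, (f i j).support.card ≤ t) →
        (Set.extremePoints ℝ (convexHull ℝ ((fun e : Fin 2 →₀ ℕ => fun i : Fin 2 => ((e i : ℕ) : ℝ)) ''
          ((∑ i, ∏ j, f i j).support : Set (Fin 2 →₀ ℕ))))).ncard ≤ (k * t + 2) ^ b := by
  obtain ⟨a, b, h⟩ := h
  refine ⟨a + b, ?_⟩
  intro k m t f hm hf
  show vert (∑ i, ∏ j, f i j) ≤ (k * t + 2) ^ (a + b)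
  have hbase : 1 ≤ k * t + 2 := by omega
  rcases Nat.eq_zero_or_pos m with rfl | hmpos
  · calc vert (∑ i, ∏ j, f i j) ≤ 1 := vert_sum_fin_zero' k f
      _ ≤ (k * t + 2) ^ (a + b) := Nat.one_le_pow _ _ hbase
  rcases Nat.eq_zero_or_pos t with rfl | htpos
  · rw [sum_prod_eq_zero_of_sparsity_zero k m hmpos f hf, vert_zero]
    exact Nat.zero_le _
  have hkpos : 0 < k := by
    rcases Nat.eq_zero_or_pos k with rfl | hk
    · simp at hm; omega
    · exact hk
  have h2m : 2 ^ (a * m) ≤ (k * t + 2) ^ a := by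
    have hkk : k ≤ k * t + 2 := by nlinarith
    calc 2 ^ (a * m) = (2 ^ m) ^ a := by rw [mul_comm, pow_mul]
      _ ≤ (2 ^ Nat.log 2 k) ^ a := Nat.pow_le_pow_left (Nat.pow_le_pow_right (by norm_num) hm) _
      _ ≤ k ^ a := Nat.pow_le_pow_left (Nat.pow_log_le_self 2 hkpos.ne') _
      _ ≤ (k * t + 2) ^ a := Nat.pow_le_pow_left hkk _
  calc vert (∑ i, ∏ j, f i j) ≤ 2 ^ (a * m) * (k * t + 2) ^ b := h k m t f hf
    _ ≤ (k * t + 2) ^ a * (k * t + 2) ^ b := Nat.mul_le_mul_right _ h2m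
    _ = (k * t + 2) ^ (a + b) := (pow_add _ _ _).symm

/-- **R1 ⟺ crux**: `LogFactorBound` (stmt-ValiantsHypothesis-16048, literal signature) is equivalent to
`NewtonTauWeak` (stmt-ValiantsHypothesis-5904). -/
theorem logFactorBound_iff_newtonTauWeak :
    (∃ b : ℕ, ∀ (k m t : ℕ) (f : Fin k → Fin m → MvPolynomial (Fin 2) ℂ), m ≤ Nat.log 2 k →
      (∀ i j, (f i j).support.card ≤ t) →
        (Set.extremePoints ℝ (convexHull ℝ ((fun e : Fin 2 →₀ ℕ => fun i : Fin 2 => ((e i : ℕ) : ℝ)) ''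
          ((∑ i, ∏ j, f i j).support : Set (Fin 2 →₀ ℕ))))).ncard ≤ (k * t + 2) ^ b) ↔
    NewtonTauWeak :=
  ⟨newtonTauWeak_of_logFactorBound, logFactorBound_of_newtonTauWeak⟩

/-! ## §3 R2 (`FewProductsBound`) is equivalent to the crux -/

/-- **Padding factors: R2 → crux.**  `FewProductsBound` (the literal signature of stmt-ValiantsHypothesis-16052)
implies `NewtonTauWeak` with `a := 2a`, `b := a + b`: append `L := ⌊log₂ k⌋ + 1` unit factors to every product,
so that `k < 2^L ≤ 2^{m+L}`, and use `2^{a L} ≤ (2k)^a ≤ 2^a (k t+2)^a ≤ 2^{a m}(k t+2)^a`, `(t+2)^b ≤ (k t+2)^b`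
(`k, m, t ≥ 1`; the corners are trivial). -/
theorem newtonTauWeak_of_fewProductsBound
    (h : ∃ a b : ℕ, ∀ (k m t : ℕ) (f : Fin k → Fin m → MvPolynomial (Fin 2) ℂ), k ≤ 2 ^ m →
      (∀ i j, (f i j).support.card ≤ t) →
        (Set.extremePoints ℝ (convexHull ℝ ((fun e : Fin 2 →₀ ℕ => fun i : Fin 2 => ((e i : ℕ) : ℝ)) ''
          ((∑ i, ∏ j, f i j).support : Set (Fin 2 →₀ ℕ))))).ncard ≤ 2 ^ (a * m) * (t + 2) ^ b) :
    NewtonTauWeak := by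
  obtain ⟨a, b, h⟩ := h
  refine ⟨2 * a, a + b, ?_⟩
  intro k m t f hf
  show vert (∑ i, ∏ j, f i j) ≤ 2 ^ (2 * a * m) * (k * t + 2) ^ (a + b)
  have hrhs : 1 ≤ 2 ^ (2 * a * m) * (k * t + 2) ^ (a + b) := Nat.one_le_iff_ne_zero.mpr (by positivity)
  rcases Nat.eq_zero_or_pos m with rfl | hm
  · exact (vert_sum_fin_zero' k f).trans hrhs
  rcases Nat.eq_zero_or_pos k with rfl | hk
  · rw [vert_sum_fin_zero]; exact Nat.zero_le _
  rcases Nat.eq_zero_or_pos t with rfl | ht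
  · rw [sum_prod_eq_zero_of_sparsity_zero k m hm f hf, vert_zero]; exact Nat.zero_le _
  -- pad every product with `L` unit factors
  set L := Nat.log 2 k + 1 with hL
  have hkL : k ≤ 2 ^ (m + L) :=
    calc k ≤ 2 ^ L := (Nat.lt_pow_succ_log_self one_lt_two k).le
      _ ≤ 2 ^ (m + L) := Nat.pow_le_pow_right (by norm_num) (Nat.le_add_left _ _)
  have hle := h k (m + L) t (fun i => Fin.append (f i) (fun (_ : Fin L) => (1 : MvPolynomial (Fin 2) ℂ))) hkL
    (fun i j => sparse_append_one m L t ht (f i) (hf i) j)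
  simp only [prod_append_one] at hle
  change vert (∑ i, ∏ j, f i j) ≤ 2 ^ (a * (m + L)) * (t + 2) ^ b at hle
  -- arithmetic: `2^{a(m+L)}(t+2)^b ≤ 2^{2am}(kt+2)^{a+b}`
  have h2L : 2 ^ L ≤ 2 * (k * t + 2) := by
    have hlog : 2 ^ Nat.log 2 k ≤ k := Nat.pow_log_le_self 2 hk.ne'
    have hkt : k ≤ k * t + 2 := by nlinarith
    calc 2 ^ L = 2 ^ Nat.log 2 k * 2 := by rw [hL, pow_succ]
      _ ≤ k * 2 := Nat.mul_le_mul_right _ hlog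
      _ ≤ (k * t + 2) * 2 := Nat.mul_le_mul_right _ hkt
      _ = 2 * (k * t + 2) := mul_comm _ _
  have htk : t + 2 ≤ k * t + 2 := by nlinarith
  have ha : 2 ^ a ≤ 2 ^ (a * m) := Nat.pow_le_pow_right (by norm_num) (Nat.le_mul_of_pos_right a hm)
  calc vert (∑ i, ∏ j, f i j) ≤ 2 ^ (a * (m + L)) * (t + 2) ^ b := hle
    _ = 2 ^ (a * m) * (2 ^ L) ^ a * (t + 2) ^ b := by ring
    _ ≤ 2 ^ (a * m) * (2 * (k * t + 2)) ^ a * (k * t + 2) ^ b :=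
        Nat.mul_le_mul (Nat.mul_le_mul_left _ (Nat.pow_le_pow_left h2L a)) (Nat.pow_le_pow_left htk b)
    _ = 2 ^ (a * m) * 2 ^ a * (k * t + 2) ^ (a + b) := by rw [mul_pow, pow_add]; ring
    _ ≤ 2 ^ (a * m) * 2 ^ (a * m) * (k * t + 2) ^ (a + b) :=
        Nat.mul_le_mul_right _ (Nat.mul_le_mul_left _ ha)
    _ = 2 ^ (2 * a * m) * (k * t + 2) ^ (a + b) := by ring

/-- **Crux → R2** (the R2 half of `RegimeSplit.subs_of_newtonTauWeak`, re-proved: `k t + 2 ≤ 2^m (t + 2)`, so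
`a := a + b`, `b := b` work). -/
theorem fewProductsBound_of_newtonTauWeak (h : NewtonTauWeak) :
    ∃ a b : ℕ, ∀ (k m t : ℕ) (f : Fin k → Fin m → MvPolynomial (Fin 2) ℂ), k ≤ 2 ^ m →
      (∀ i j, (f i j).support.card ≤ t) →
        (Set.extremePoints ℝ (convexHull ℝ ((fun e : Fin 2 →₀ ℕ => fun i : Fin 2 => ((e i : ℕ) : ℝ)) ''
          ((∑ i, ∏ j, f i j).support : Set (Fin 2 →₀ ℕ))))).ncard ≤ 2 ^ (a * m) * (t + 2) ^ b := by
  obtain ⟨a, b, h⟩ := h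
  refine ⟨a + b, b, ?_⟩
  intro k m t f hk hf
  show vert (∑ i, ∏ j, f i j) ≤ 2 ^ ((a + b) * m) * (t + 2) ^ b
  have hkt : k * t + 2 ≤ 2 ^ m * (t + 2) := by
    have h1 : 1 ≤ 2 ^ m := Nat.one_le_two_pow
    have : k * t ≤ 2 ^ m * t := Nat.mul_le_mul_right _ hk
    nlinarith
  calc vert (∑ i, ∏ j, f i j) ≤ 2 ^ (a * m) * (k * t + 2) ^ b := h k m t f hf
    _ ≤ 2 ^ (a * m) * (2 ^ m * (t + 2)) ^ b := Nat.mul_le_mul_left _ (Nat.pow_le_pow_left hkt _)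
    _ = 2 ^ ((a + b) * m) * (t + 2) ^ b := by rw [mul_pow, ← pow_mul]; ring

/-- **R2 ⟺ crux**: `FewProductsBound` (stmt-ValiantsHypothesis-16052, literal signature) is equivalent to
`NewtonTauWeak` (stmt-ValiantsHypothesis-5904). -/
theorem fewProductsBound_iff_newtonTauWeak :
    (∃ a b : ℕ, ∀ (k m t : ℕ) (f : Fin k → Fin m → MvPolynomial (Fin 2) ℂ), k ≤ 2 ^ m →
      (∀ i j, (f i j).support.card ≤ t) →
        (Set.extremePoints ℝ (convexHull ℝ ((fun e : Fin 2 →₀ ℕ => fun i : Fin 2 => ((e i : ℕ) : ℝ)) ''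
          ((∑ i, ∏ j, f i j).support : Set (Fin 2 →₀ ℕ))))).ncard ≤ 2 ^ (a * m) * (t + 2) ^ b) ↔
    NewtonTauWeak :=
  ⟨newtonTauWeak_of_fewProductsBound, fewProductsBound_of_newtonTauWeak⟩

/-! ## §4 The split is degenerate: R1 ⟺ R2 -/

/-- **R1 ⟺ R2**: the two "regimes" of the split `NewtonTauWeak ↔ R1 ∧ R2` are equivalent to each other (and to
the crux), so the split separates nothing. -/
theorem logFactorBound_iff_fewProductsBound :
    (∃ b : ℕ, ∀ (k m t : ℕ) (f : Fin k → Fin m → MvPolynomial (Fin 2) ℂ), m ≤ Nat.log 2 k →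
      (∀ i j, (f i j).support.card ≤ t) →
        (Set.extremePoints ℝ (convexHull ℝ ((fun e : Fin 2 →₀ ℕ => fun i : Fin 2 => ((e i : ℕ) : ℝ)) ''
          ((∑ i, ∏ j, f i j).support : Set (Fin 2 →₀ ℕ))))).ncard ≤ (k * t + 2) ^ b) ↔
    (∃ a b : ℕ, ∀ (k m t : ℕ) (f : Fin k → Fin m → MvPolynomial (Fin 2) ℂ), k ≤ 2 ^ m →
      (∀ i j, (f i j).support.card ≤ t) →
        (Set.extremePoints ℝ (convexHull ℝ ((fun e : Fin 2 →₀ ℕ => fun i : Fin 2 => ((e i : ℕ) : ℝ)) ''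
          ((∑ i, ∏ j, f i j).support : Set (Fin 2 →₀ ℕ))))).ncard ≤ 2 ^ (a * m) * (t + 2) ^ b) :=
  logFactorBound_iff_newtonTauWeak.trans fewProductsBound_iff_newtonTauWeak.symm

/-! ## §5 The general principle: free padding = monotone envelope of any regime bound -/

/-- Padding both ways at once: `k' - k` zero products and `m' - m` unit factors leave `Σ_i Π_j f i j` unchanged
(`m ≥ 1`). -/
theorem sum_prod_pad (k n m L : ℕ) (hm : 0 < m) (f : Fin k → Fin m → MvPolynomial (Fin 2) ℂ) :
    (∑ i : Fin (k + n), ∏ j : Fin (m + L),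
        Fin.append (Fin.append f (fun (_ : Fin n) (_ : Fin m) => (0 : MvPolynomial (Fin 2) ℂ)) i)
          (fun (_ : Fin L) => (1 : MvPolynomial (Fin 2) ℂ)) j) = ∑ i, ∏ j, f i j := by
  simp only [prod_append_one]
  exact sum_prod_append_zero k n m hm f

/-- The doubly padded family is `t`-sparse (`t ≥ 1`). -/
theorem sparse_pad (k n m L t : ℕ) (ht : 1 ≤ t) (f : Fin k → Fin m → MvPolynomial (Fin 2) ℂ)
    (hf : ∀ i j, (f i j).support.card ≤ t) (i : Fin (k + n)) (j : Fin (m + L)) :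
    (Fin.append (Fin.append f (fun (_ : Fin n) (_ : Fin m) => (0 : MvPolynomial (Fin 2) ℂ)) i)
        (fun (_ : Fin L) => (1 : MvPolynomial (Fin 2) ℂ)) j).support.card ≤ t :=
  sparse_append_one m L t ht _ (fun j => sparse_append_zero k n m t f hf i j) j

/-- **Free padding (the monotone envelope of a regime bound).**  If a vertex bound `B k m t` is known for all
`Σ^k Π^m` shapes in some regime `R k m`, then EVERY `Σ^k Π^m` expression of `t`-sparse factors (`m, t ≥ 1`) already
obeys `B k' m' t` for every `(k', m') ≥ (k, m)` lying in the regime — pad with `k' - k` zero products and `m' - m` unit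
factors.  So a regime restriction that leaves, above every `(k, m)`, some point of the regime is no restriction at all:
the bound is silently replaced by its monotone envelope `inf {B k' m' t : k' ≥ k, m' ≥ m, R k' m'}`.  (R1: `R k m :=
m ≤ log₂ k`, envelope `((max k 2^m) t + 2)^b`; R2: `R k m := k ≤ 2^m`, envelope `2^{a max(m, ⌊log₂ k⌋+1)}(t+2)^b` — both
of the crux's own shape `2^{O(m)}(kt+2)^{O(1)}`, which is §2–§3.) -/
theorem vert_le_of_regime_bound (R : ℕ → ℕ → Prop) (B : ℕ → ℕ → ℕ → ℕ)
    (hB : ∀ (k m t : ℕ) (f : Fin k → Fin m → MvPolynomial (Fin 2) ℂ), R k m →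
      (∀ i j, (f i j).support.card ≤ t) → vert (∑ i, ∏ j, f i j) ≤ B k m t)
    (k m t : ℕ) (f : Fin k → Fin m → MvPolynomial (Fin 2) ℂ) (hm : 1 ≤ m) (ht : 1 ≤ t)
    (hf : ∀ i j, (f i j).support.card ≤ t) (k' m' : ℕ) (hk : k ≤ k') (hm' : m ≤ m') (hR : R k' m') :
    vert (∑ i, ∏ j, f i j) ≤ B k' m' t := by
  obtain ⟨n, rfl⟩ := Nat.exists_eq_add_of_le hk
  obtain ⟨L, rfl⟩ := Nat.exists_eq_add_of_le hm'
  have h := hB (k + n) (m + L) t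
    (fun i => Fin.append (Fin.append f (fun (_ : Fin n) (_ : Fin m) => (0 : MvPolynomial (Fin 2) ℂ)) i)
      (fun (_ : Fin L) => (1 : MvPolynomial (Fin 2) ℂ))) hR (sparse_pad k n m L t ht f hf)
  rwa [sum_prod_pad k n m L hm f] at h

end Summit.ValiantsHypothesis.ValiantsHypothesis.Theorems.NewtonUnitEquationsLogFactorBound
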